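import Literature.AlgebraicGeometry.HodgeTheory.ComplexTorusIntegralHodgeClassesLefschetzDecompositionMotivicConstituents
import HarnessLib

/-!
# Künnemann's idempotents across the weights: orthogonality, the self-transpose middle projectors, `ℚ`-linear independence of the whole family
# `{e_{s,i}}_{s ≤ g} ∪ {ᵗe_{s,i}}_{s < g}`, and the bounds `dim_ℚ Bᵍ(X × X), dim_ℚ Dᵍ(X × X) ≥ Σ_{s=0}^{2g} (⌊min(s, 2g−s)/2⌋ + 1)`
# (Künnemann; Milne §5; Lange §6.3.4; Kahn §6.12)

Layer `Literature/AlgebraicGeometry/HodgeTheory`, namespace `Literature.AlgebraicGeometry.HodgeTheory.ComplexTorusCat`; lane `lit-hodgefound` (Track 2 foundations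
library, Layer A1/A4), prover seat `lit-hodgefound-p35` (gen 44, row g44-#4). Sequel of g43-#6 (`…LefschetzDecompositionEulerCharacteristics`: Künnemann's idempotents
`e_{s,i} = N_s⁻¹ρ(p_{s,i})` of p08's complex correspondence algebra `CorrRing`, `Σᵢ e_{s,i} = π_s`) and g44-#2 (`…LefschetzDecompositionMotivicConstituents`: `e_{s,i} ≠ 0`, the transposed
idempotents `e′_{s,i} = N_s⁻¹ρ(τ_*p_{s,i}) = ᵗe_{s,i}` with `Σᵢ e′_{s,i} = π_{2g−s}`). For a complex torus `X` of dimension `g` with `Θ ∈ NS(X)` non-degenerate, `Θ^{[g]} = D·[pt]`: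

* §1 **ACROSS THE WEIGHTS ALL PRODUCTS VANISH**: `e′_{s,i} ∘ π_{2g−s} = e′_{s,i} = π_{2g−s} ∘ e′_{s,i}` (transposes of g43-#6's `e ∘ π_s = e = π_s ∘ e`, `ᵗπ_s = π_{2g−s}`); hence
  `e_{s,i} ∘ e_{t,j} = 0`, `e′ ∘ e′ = 0`, `e ∘ e′ = 0`, `e′ ∘ e = 0` whenever the weights differ (`π_a ∘ π_b = 0`, p08 `kunnethIdem_mul_kunnethIdem`); and `(e′_{s,i})_* = 0` off degree
  `2g − s`;
* §2 **THE MIDDLE PROJECTORS ARE SYMMETRIC CORRESPONDENCES: `ᵗe_{g,i} = e_{g,i}`** (`s = g`): both act as `π_{g,i}` on `Hᵍ(X, ℂ)` and as `0` elsewhere (g43-#6, g44-#2 with `j = 0`), and a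
  degree-`0` correspondence is determined by its actions (p08 `endAlgHom_injective`) — Kleiman's `ᵗp^{g,i} = p^{g,i}`;
* §3 **`ℚ`-LINEAR INDEPENDENCE**: pairwise orthogonal non-zero idempotents of a `ℚ`-algebra are linearly independent (`linearIndependent_of_isIdempotentElem_of_mul_eq_zero`, bookkeeping),
  so the family `v` of ALL Künnemann idempotents — `e_{s,i}` for the complete towers of weight `s ≤ g` and `e′_{t,i}` of weight `2g − t`, `t < g` — indexed by
  `KunnemannIndex g = (Σ_{s ≤ g} Fin(⌊s/2⌋+1)) ⊕ (Σ_{t < g} Fin(⌊t/2⌋+1))`, is linearly independent in `CorrRing`, in `Bᵍ(X × X)` and in `Dᵍ(X × X)`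
  (`linearIndependent_kunnemannFamily`, `…_hodgeCorr`, `…_lefschetzCorr`);
* §4 **DIMENSION BOUNDS** on a polarized complex torus of type `(d₁, …, d_g)` (towers from `θ`, `N_s ≠ 0` unconditionally): **`card_kunnemannIndex_le_finrank_hodgeCorr`**
  `#KunnemannIndex g ≤ dim_ℚ Bᵍ(X × X)` and **`…_lefschetzCorr`** `≤ dim_ℚ Dᵍ(X × X)`, with the count **`card_kunnemannIndex`** `#KunnemannIndex g = Σ_{s=0}^{2g} (⌊min(s, 2g−s)/2⌋ + 1)`
  (`= 3, 6, 10, 15, 21, …` for `g = 1, 2, 3, 4, 5`; the bound is an equality for a Lefschetz-generic abelian variety — not proved here).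

* §5 (appended, g44-#7) **KÜNNEMANN's REFINED DECOMPOSITION IS COMPLETE: `Σ_{a ∈ KunnemannIndex} e_a = 1 = [Δ]`** (`sum_kunnemannFamily`; weight by weight `Σᵢ e_{s,i} = π_s`,
  `Σᵢ e′_{t,i} = π_{2g−t}`, and p08's `Σ_s π_s = 1`) — together with §3 the motive `h(X)` of a complex torus with `Θ^{[g]} = D·[pt]`, all `N_s ≠ 0`, splits into
  `#KunnemannIndex g` pairwise orthogonal non-zero idempotents; the EULER CHARACTERISTICS of the pieces `τ(e_{s,i}) = (−1)ˢ b^pr_{s−2i}`, `τ(e′_{t,i}) = (−1)ᵗ b^pr_{t−2i}`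
  (`traceForm_kunnemannFamily_inl ∕ _inr`, ✔ g43-#6 ∕ g44-#2) add up to `τ(1) = χ(X) = 0` (`sum_traceForm_kunnemannFamily`, `g ≥ 1`): **`Σ_{s ≤ g} Σ_{i ≤ s/2} (−1)ˢ b^pr_{s−2i} +
  Σ_{t < g} Σ_{i ≤ t/2} (−1)ᵗ b^pr_{t−2i} = 0`** (`sum_neg_one_pow_mul_primitiveBettiNumber_kunnemannIndex_eq_zero`, Kahn's additivity of `χ` over a decomposition of `1`).

One definition with body (`KunnemannIndex`, an index TYPE — `abbrev` of a `Sum` of `Sigma` types, no mathematics) and `kunnemannFamily` (the family `v`, an `abbrev`); theorems otherwise;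
NO named fact, no `sorry` (D-0026); no `instance`, no notation.

## The sources, as printed

J. S. Milne, *Lefschetz classes on abelian varieties*, Duke Math. J. 96 (1999), held `paper:doi-10-1215-s0012-7094-99-09620-5`, §5 p. 664 (p0026 L42–L50) (the Lefschetz
decomposition, `sp^{s−2i}`), Thm. 5.9 with proof (p0026 L74 – p0027 L9). H. Lange, *Abelian Varieties over the Complex Numbers* (2023), held `book:lange1992-complex-abelian-varieties`,
§6.3.4 Prop. 6.3.9–6.3.11 (p0317–p0319) (`π_i`, `ᵗπ_i = π_{2g−i}`, `π_i π_j = 0`), §6.2.2 p. 304 (`ᵗZ`), §7.3.2 (3) (p0338 L12–L16), §3.6 Thm. 3.6.1. B. Kahn, *Zeta and L-Functions of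
Varieties and Motives* (CUP 2020), held `book:kahn2020-zeta-l-functions-varieties-motives`, §6.12.2 Cor. 6.42 / Def. 6.43 (p0129), §6.7 Thm. 6.20 (p0121), App. A Thm. A.6 (p0135).
W. Fulton, *Intersection Theory* (2nd ed. 1998), §16.1 Prop. 16.1.1 (b), Prop. 16.1.2 (b), Example 16.1.15 (p0302 L27–L40).

## References
* [Kunnemann1993] K. Künnemann, A Lefschetz decomposition for Chow motives of abelian schemes, Invent. Math. 113 (1993) 85–102 (not held; through Milne §5 and Murre §7.18).
* [Milne1999LefschetzClasses] J. S. Milne, Lefschetz classes on abelian varieties, Duke Math. J. 96 (1999) — §5 p. 664 (p0026 L42–L50), Thm. 5.9, Cor. 5.3.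
* [Lange2023AbelianVarietiesComplex] H. Lange, Abelian Varieties over the Complex Numbers, Springer 2023 — §6.2.2 p. 304, §6.3.4 Prop. 6.3.9–6.3.11 (p0317–p0319), §7.3.2 (3), §3.6 Thm. 3.6.1.
* [Kahn2020] B. Kahn, Zeta and L-Functions of Varieties and Motives, LMS LN 462, CUP 2020 — §6.7 Thm. 6.20, §6.12.2 Cor. 6.42 / Def. 6.43 (p0129), App. A Thm. A.6.
* [Fulton1998] W. Fulton, Intersection Theory, 2nd ed., Springer 1998 — §16.1 Prop. 16.1.1 (b), Prop. 16.1.2 (b), Example 16.1.15 (p0302 L27–L40).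
* [Kleiman1968AlgebraicCycles] S. L. Kleiman, Algebraic cycles and the Weil conjectures, in: Dix exposés sur la cohomologie des schémas, North-Holland 1968 — §1.4 (not held; acq-14408; through Milne §5).
-/

noncomputable section

open CategoryTheory Function MulOpposite

namespace Literature.AlgebraicGeometry.HodgeTheory

open Literature.AlgebraicGeometry.Motives Literature.AlgebraicGeometry.Motives.HodgeStructure
open Literature.Geometry.Kaehler Literature.Geometry.Kaehler.ComplexTorus
open Literature.LinearAlgebra.Alternating Literature.Analysis.Complex
open Literature.RingTheory.Idempotents

namespace ComplexTorusCat

/-! ## §0 Bookkeeping: orthogonal non-zero idempotents of a `ℚ`-algebra are linearly independent -/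

section Generic

/-- **Pairwise orthogonal non-zero idempotents `(vᵢ)` of a `ℚ`-algebra are `ℚ`-linearly independent** (multiply a relation `Σ cⱼ vⱼ = 0` by `vᵢ`: `cᵢ vᵢ = 0`).
[cite: Lam2001FirstCourse, §21 (21.1)–(21.3)] -/
theorem linearIndependent_of_isIdempotentElem_of_mul_eq_zero {A : Type*} [Ring A] [Algebra ℚ A] {I : Type*} (v : I → A) (hv : ∀ i, IsIdempotentElem (v i))
    (hvo : ∀ i j, i ≠ j → v i * v j = 0) (hv0 : ∀ i, v i ≠ 0) : LinearIndependent ℚ v := by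
  classical
  rw [linearIndependent_iff']
  intro s c hsum i hi
  have h := congrArg (fun x ↦ v i * x) hsum
  simp only [Finset.mul_sum, mul_smul_comm, mul_zero] at h
  rw [Finset.sum_eq_single i (fun j _ hji ↦ by rw [hvo i j (Ne.symm hji), smul_zero]) (fun hi' ↦ (hi' hi).elim), (hv i).eq] at h
  by_contra hc
  exact hv0 i (by rw [← one_smul ℚ (v i), ← inv_mul_cancel₀ hc, mul_smul, h, smul_zero])

variable {ι : Type*} [Fintype ι] [DecidableEq ι] {E : Type*} [NormedAddCommGroup E] [NormedSpace ℂ E] (Φ : (ι → ℝ) ≃L[ℝ] E) {g : ℕ} (e : Fin (g + g) ≃ ι)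
  (he : orientationSign Φ e = 1) (e' : Fin ((g + g) + (g + g)) ≃ ι ⊕ ι)

/-- Elements of p08's algebra of different Künneth weights are orthogonal: `x = x ∘ π_a`, `y = π_b ∘ y`, `a ≠ b` ⇒ `x ∘ y = x ∘ π_a ∘ π_b ∘ y = 0`.
[cite: Lange2023AbelianVarietiesComplex, §6.3.4 Prop. 6.3.9 (a) and Prop. 6.3.11 (p0318–p0319)] -/
private theorem mul_eq_zero_of_weights₅₀ {x y : CorrRing Φ e he e'} {a b : ℕ} (hx : x * CorrRing.kunnethIdem Φ e he e' a = x) (hy : CorrRing.kunnethIdem Φ e he e' b * y = y)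
    (hab : a ≠ b) : x * y = 0 := by
  rw [← hx, ← hy, mul_assoc, ← mul_assoc (CorrRing.kunnethIdem Φ e he e' a), CorrRing.kunnethIdem_mul_kunnethIdem, if_neg hab, zero_mul, mul_zero]

/-- A linearly independent family of `CorrRing` lying in a `ℚ`-subalgebra `A` is linearly independent in `A`. [folklore] -/
private theorem linearIndependent_subalgebra₅₀ (A : Subalgebra ℚ (CorrRing Φ e he e')) {I : Type*} {v : I → CorrRing Φ e he e'} (hmem : ∀ i, v i ∈ A)
    (hv : LinearIndependent ℚ v) : LinearIndependent ℚ fun i ↦ (⟨v i, hmem i⟩ : A) :=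
  LinearIndependent.of_comp A.val.toLinearMap (by exact hv)

end Generic

/-! ## The index type of Künnemann's family -/

/-- **The index set of the full family of Künnemann idempotents of a `g`-dimensional torus**: a weight `s ≤ g` with a member `i ≤ ⌊s/2⌋` of the complete tower of weight `s`
(the idempotents `e_{s,i}` of `hˢ(X)`), or a co-weight `t < g` with a member `i ≤ ⌊t/2⌋` (the transposed idempotents `e′_{t,i}` of `h^{2g−t}(X)`). An index TYPE only.
[cite: Milne1999LefschetzClasses, §5 p. 664 (p0026 L42–L50)] [cite: Kunnemann1993] -/
abbrev KunnemannIndex (g : ℕ) : Type := (Σ s : Fin (g + 1), Fin ((s : ℕ) / 2 + 1)) ⊕ (Σ t : Fin g, Fin ((t : ℕ) / 2 + 1))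

/-- **`#KunnemannIndex g = Σ_{s ≤ g} (⌊s/2⌋ + 1) + Σ_{t < g} (⌊t/2⌋ + 1)`.** [cite: Milne1999LefschetzClasses, §5 p. 664 (p0026 L42–L50)] -/
theorem card_kunnemannIndex_eq_add (g : ℕ) :
    Fintype.card (KunnemannIndex g) = ∑ s : Fin (g + 1), ((s : ℕ) / 2 + 1) + ∑ t : Fin g, ((t : ℕ) / 2 + 1) := by
  simp only [KunnemannIndex, Fintype.card_sum, Fintype.card_sigma, Fintype.card_fin]

/-- **`#KunnemannIndex g = Σ_{s=0}^{2g} (⌊min(s, 2g−s)/2⌋ + 1)`** — the weight-wise constituent bound of g44-#2 summed over all weights (`min(s, 2g−s) = s` for `s ≤ g`, `= 2g − s =: t < g`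
for `s > g`). [cite: Milne1999LefschetzClasses, §5 p. 664 (p0026 L42–L50)] [cite: Kahn2020, §6.12.2 Cor. 6.42 and Def. 6.43 (p0129)] -/
theorem card_kunnemannIndex (g : ℕ) : Fintype.card (KunnemannIndex g) = ∑ s : Fin (g + g + 1), (min (s : ℕ) (g + g - s) / 2 + 1) := by
  rw [card_kunnemannIndex_eq_add]
  simp only [Fin.sum_univ_eq_sum_range (fun s : ℕ ↦ s / 2 + 1), Fin.sum_univ_eq_sum_range (fun s : ℕ ↦ min s (g + g - s) / 2 + 1)]
  -- split `range (2g + 1) = range (g + 1) ∪ ((g + 1) + range g)` on the right, reflect `range g` on the left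
  have hsplit := Finset.sum_range_add (fun s ↦ min s (g + g - s) / 2 + 1) (g + 1) g
  have hrefl := Finset.sum_range_reflect (fun t ↦ t / 2 + 1) g
  rw [show g + 1 + g = g + g + 1 by omega] at hsplit
  rw [hsplit, ← hrefl]
  congr 1
  · exact Finset.sum_congr rfl fun s hs ↦ by
      have := Finset.mem_range.1 hs
      rw [min_eq_left (by omega)]
  · exact Finset.sum_congr rfl fun t ht ↦ by
      have := Finset.mem_range.1 ht
      rw [min_eq_right (by omega), show g + g - (g + 1 + t) = g - 1 - t by omega]

section Kunnemann

variable (X : ComplexTorusCat) {gX gXX gT : ℕ} (hTX : gXX + gX = gT) (eX : Fin (2 * gX) ≃ X.toIsog.ι) (eXX : Fin (2 * gXX) ≃ (prodObj X X).toIsog.ι)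
  (eT : Fin (2 * gT) ≃ (prodObj X (prodObj X X)).toIsog.ι) (hX0 : 2 * gX + 2 * 0 = 2 * gX) (hgX : gX + gX = 2 * gX) (hcX : 2 * gX + 2 * gX = 2 * gXX)
  (hgXX : gXX + gXX = 2 * gXX) (hgg₂ : gX + gX = gXX) (hN' : 2 * gX + 2 * gXX = 2 * gT) (hgT : gT + gT = 2 * gT)
  (f : Fin (gX + gX) ≃ X.toIsog.ι) (hf : orientationSign X.toIsog.Φ f = 1) (f' : Fin ((gX + gX) + (gX + gX)) ≃ X.toIsog.ι ⊕ X.toIsog.ι)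
  (Θ : neronSeveriGroup X.toIsog.Φ) (D : ℤ) {c₁ bc m₂ d₂ l₁ l₇ l₉ : ℕ} (hbc₁ : bc + 1 = gXX)
  (hl₁ : l₁ + 2 * 1 = 2 * gX) (hl₁' : l₁ + 2 * c₁ = 2 * gXX) (h7 : l₇ + 2 * bc = 2 * gT) (h7' : l₇ + 2 * m₂ = 2 * gXX) (hmX : m₂ + gX = bc)
  (hΛL : m₂ + c₁ = d₂) (h9 : l₉ + 2 * d₂ = 2 * gT) (h9' : l₉ + 2 * gX = 2 * gXX)
  (hnd : ∀ v : X.toIsog.E, v ≠ 0 → ∃ w : X.toIsog.E, (Θ : X.toIsog.E [⋀^Fin 2]→L[ℝ] ℝ) ![v, w] ≠ 0)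

/-! ## §1 Across the weights -/

/-- **`e′_{s,i} ∘ π_{2g−s} = e′_{s,i}`** (`s + t = 2g`): the transpose of `π_s ∘ e_{s,i} = e_{s,i}` (g43-#6), `ᵗ(ab) = ᵗb ᵗa`, `ᵗπ_s = π_{2g−s}` (p08). [cite: Lange2023AbelianVarietiesComplex, §6.3.4 Prop. 6.3.10 (p0318) and §6.2.2 p. 304]
[cite: Kunnemann1993] -/
theorem inv_smul_integralHodgeClassesCorrRingHom_pushforward_swapHom_lefschetzFamily_mul_kunnethIdem (hΘ : nsDivPower X Θ gX = D • pointIntegralHodgeClass X eX) (s₀ k : ℕ)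
    (hk : s₀ + 2 * k ≤ gX + 1) {t : ℕ} (hst : (s₀ + 2 * k) + t = gX + gX) (i : Fin (k + 1)) :
    (lefschetzFamilyConstant gX D s₀ k : ℚ)⁻¹ • integralHodgeClassesCorrRingHom X hTX eX eXX eT hX0 hgX hcX hgXX hgg₂ hN' hgT f hf f'
          (integralHodgeClassesPushforward gX gX (swapHom X X) eXX eXX hcX hgXX hcX hgXX
            (lefschetzFamily X eX eXX eT hX0 hgX hcX hgXX hgT hN' hgg₂ Θ D hbc₁ hl₁ hl₁' h7 h7' hmX hΛL h9 h9' s₀ k hk i)) *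
        CorrRing.kunnethIdem X.toIsog.Φ f hf f' t =
      (lefschetzFamilyConstant gX D s₀ k : ℚ)⁻¹ • integralHodgeClassesCorrRingHom X hTX eX eXX eT hX0 hgX hcX hgXX hgg₂ hN' hgT f hf f'
          (integralHodgeClassesPushforward gX gX (swapHom X X) eXX eXX hcX hgXX hcX hgXX
            (lefschetzFamily X eX eXX eT hX0 hgX hcX hgXX hgT hN' hgg₂ Θ D hbc₁ hl₁ hl₁' h7 h7' hmX hΛL h9 h9' s₀ k hk i)) := by
  rw [inv_smul_integralHodgeClassesCorrRingHom_pushforward_swapHom_lefschetzFamily, ← CorrRing.transpose_kunnethIdem X.toIsog.Φ f hf f' _ _ hst, ← CorrRing.transpose_mul,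
    kunnethIdem_mul_inv_smul_integralHodgeClassesCorrRingHom_lefschetzFamily X hTX eX eXX eT hX0 hgX hcX hgXX hgg₂ hN' hgT f hf f' Θ D hbc₁ hl₁ hl₁' h7 h7' hmX hΛL h9 h9' hΘ s₀ k hk i]

/-- **`π_{2g−s} ∘ e′_{s,i} = e′_{s,i}`** (`s + t = 2g`): the transpose of `e_{s,i} ∘ π_s = e_{s,i}`. [cite: Lange2023AbelianVarietiesComplex, §6.3.4 Prop. 6.3.10 (p0318) and §6.2.2 p. 304] [cite: Kunnemann1993] -/
theorem kunnethIdem_mul_inv_smul_integralHodgeClassesCorrRingHom_pushforward_swapHom_lefschetzFamily (hΘ : nsDivPower X Θ gX = D • pointIntegralHodgeClass X eX) (s₀ k : ℕ)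
    (hk : s₀ + 2 * k ≤ gX + 1) {t : ℕ} (hst : (s₀ + 2 * k) + t = gX + gX) (i : Fin (k + 1)) :
    CorrRing.kunnethIdem X.toIsog.Φ f hf f' t *
        (lefschetzFamilyConstant gX D s₀ k : ℚ)⁻¹ • integralHodgeClassesCorrRingHom X hTX eX eXX eT hX0 hgX hcX hgXX hgg₂ hN' hgT f hf f'
          (integralHodgeClassesPushforward gX gX (swapHom X X) eXX eXX hcX hgXX hcX hgXX
            (lefschetzFamily X eX eXX eT hX0 hgX hcX hgXX hgT hN' hgg₂ Θ D hbc₁ hl₁ hl₁' h7 h7' hmX hΛL h9 h9' s₀ k hk i)) =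
      (lefschetzFamilyConstant gX D s₀ k : ℚ)⁻¹ • integralHodgeClassesCorrRingHom X hTX eX eXX eT hX0 hgX hcX hgXX hgg₂ hN' hgT f hf f'
          (integralHodgeClassesPushforward gX gX (swapHom X X) eXX eXX hcX hgXX hcX hgXX
            (lefschetzFamily X eX eXX eT hX0 hgX hcX hgXX hgT hN' hgg₂ Θ D hbc₁ hl₁ hl₁' h7 h7' hmX hΛL h9 h9' s₀ k hk i)) := by
  rw [(CorrRing.commute_kunnethIdem X.toIsog.Φ f hf f' t _).eq,
    inv_smul_integralHodgeClassesCorrRingHom_pushforward_swapHom_lefschetzFamily_mul_kunnethIdem X hTX eX eXX eT hX0 hgX hcX hgXX hgg₂ hN' hgT f hf f' Θ D hbc₁ hl₁ hl₁' h7 h7'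
      hmX hΛL h9 h9' hΘ s₀ k hk hst i]

/-- **`(e′_{s,i})_* = 0` ON `Hᵈ(X, ℂ)` FOR `d ≠ 2g − s`** (`e′ = e′ ∘ π_{2g−s}` and `(π_t)_* = δ_{t,d}`). [cite: Lange2023AbelianVarietiesComplex, §6.3.4 Prop. 6.3.11 (p0319 L9–L21)] [cite: Kunnemann1993] -/
theorem coact_inv_smul_integralHodgeClassesCorrRingHom_pushforward_swapHom_lefschetzFamily_of_ne (hΘ : nsDivPower X Θ gX = D • pointIntegralHodgeClass X eX) (s₀ k : ℕ)
    (hk : s₀ + 2 * k ≤ gX + 1) {t : ℕ} (hst : (s₀ + 2 * k) + t = gX + gX) (i : Fin (k + 1)) {d : ℕ} (hd : d ≤ gX + gX) (hdt : d ≠ t) :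
    CorrRing.coact X.toIsog.Φ f hf f' d hd
        ((lefschetzFamilyConstant gX D s₀ k : ℚ)⁻¹ • integralHodgeClassesCorrRingHom X hTX eX eXX eT hX0 hgX hcX hgXX hgg₂ hN' hgT f hf f'
          (integralHodgeClassesPushforward gX gX (swapHom X X) eXX eXX hcX hgXX hcX hgXX
            (lefschetzFamily X eX eXX eT hX0 hgX hcX hgXX hgT hN' hgg₂ Θ D hbc₁ hl₁ hl₁' h7 h7' hmX hΛL h9 h9' s₀ k hk i))) = 0 := by
  rw [← inv_smul_integralHodgeClassesCorrRingHom_pushforward_swapHom_lefschetzFamily_mul_kunnethIdem X hTX eX eXX eT hX0 hgX hcX hgXX hgg₂ hN' hgT f hf f' Θ D hbc₁ hl₁ hl₁' h7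
      h7' hmX hΛL h9 h9' hΘ s₀ k hk hst i, CorrRing.coact_mul, CorrRing.coact_kunnethIdem, if_neg (Ne.symm hdt), mul_zero]

/-- **`e_{s,i} ∘ e_{t,j} = 0` FOR TOWERS OF DIFFERENT WEIGHTS `s ≠ t`** (`e_{s,i} = e_{s,i} ∘ π_s`, `e_{t,j} = π_t ∘ e_{t,j}`, `π_s ∘ π_t = 0`).
[cite: Lange2023AbelianVarietiesComplex, §6.3.4 Prop. 6.3.9 (a) and Prop. 6.3.11 (p0318–p0319)] [cite: Kunnemann1993] -/
theorem inv_smul_integralHodgeClassesCorrRingHom_lefschetzFamily_mul_of_weight_ne (hΘ : nsDivPower X Θ gX = D • pointIntegralHodgeClass X eX) (s₀ k : ℕ)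
    (hk : s₀ + 2 * k ≤ gX + 1) (t₀ l : ℕ) (hl : t₀ + 2 * l ≤ gX + 1) (hst : s₀ + 2 * k ≠ t₀ + 2 * l) (i : Fin (k + 1)) (j : Fin (l + 1)) :
    (lefschetzFamilyConstant gX D s₀ k : ℚ)⁻¹ • integralHodgeClassesCorrRingHom X hTX eX eXX eT hX0 hgX hcX hgXX hgg₂ hN' hgT f hf f'
          (lefschetzFamily X eX eXX eT hX0 hgX hcX hgXX hgT hN' hgg₂ Θ D hbc₁ hl₁ hl₁' h7 h7' hmX hΛL h9 h9' s₀ k hk i) *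
        (lefschetzFamilyConstant gX D t₀ l : ℚ)⁻¹ • integralHodgeClassesCorrRingHom X hTX eX eXX eT hX0 hgX hcX hgXX hgg₂ hN' hgT f hf f'
          (lefschetzFamily X eX eXX eT hX0 hgX hcX hgXX hgT hN' hgg₂ Θ D hbc₁ hl₁ hl₁' h7 h7' hmX hΛL h9 h9' t₀ l hl j) = 0 :=
  mul_eq_zero_of_weights₅₀ X.toIsog.Φ f hf f'
    (inv_smul_integralHodgeClassesCorrRingHom_lefschetzFamily_mul_kunnethIdem X hTX eX eXX eT hX0 hgX hcX hgXX hgg₂ hN' hgT f hf f' Θ D hbc₁ hl₁ hl₁' h7 h7' hmX hΛL h9 h9' hΘ s₀ k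
      hk i)
    (kunnethIdem_mul_inv_smul_integralHodgeClassesCorrRingHom_lefschetzFamily X hTX eX eXX eT hX0 hgX hcX hgXX hgg₂ hN' hgT f hf f' Θ D hbc₁ hl₁ hl₁' h7 h7' hmX hΛL h9 h9' hΘ t₀ l
      hl j) hst

/-- **`e′_{s,i} ∘ e′_{t,j} = 0` FOR TRANSPOSED TOWERS OF DIFFERENT CO-WEIGHTS** (`s + s′ = 2g = t + t′`, `s′ ≠ t′`). [cite: Lange2023AbelianVarietiesComplex, §6.3.4 Prop. 6.3.9–6.3.11 (p0318–p0319)]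
[cite: Kunnemann1993] -/
theorem inv_smul_integralHodgeClassesCorrRingHom_pushforward_swapHom_lefschetzFamily_mul_of_weight_ne (hΘ : nsDivPower X Θ gX = D • pointIntegralHodgeClass X eX)
    (s₀ k : ℕ) (hk : s₀ + 2 * k ≤ gX + 1) {s' : ℕ} (hs' : (s₀ + 2 * k) + s' = gX + gX) (t₀ l : ℕ) (hl : t₀ + 2 * l ≤ gX + 1) {t' : ℕ} (ht' : (t₀ + 2 * l) + t' = gX + gX)
    (hst : s' ≠ t') (i : Fin (k + 1)) (j : Fin (l + 1)) :
    (lefschetzFamilyConstant gX D s₀ k : ℚ)⁻¹ • integralHodgeClassesCorrRingHom X hTX eX eXX eT hX0 hgX hcX hgXX hgg₂ hN' hgT f hf f'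
          (integralHodgeClassesPushforward gX gX (swapHom X X) eXX eXX hcX hgXX hcX hgXX
            (lefschetzFamily X eX eXX eT hX0 hgX hcX hgXX hgT hN' hgg₂ Θ D hbc₁ hl₁ hl₁' h7 h7' hmX hΛL h9 h9' s₀ k hk i)) *
        (lefschetzFamilyConstant gX D t₀ l : ℚ)⁻¹ • integralHodgeClassesCorrRingHom X hTX eX eXX eT hX0 hgX hcX hgXX hgg₂ hN' hgT f hf f'
          (integralHodgeClassesPushforward gX gX (swapHom X X) eXX eXX hcX hgXX hcX hgXX
            (lefschetzFamily X eX eXX eT hX0 hgX hcX hgXX hgT hN' hgg₂ Θ D hbc₁ hl₁ hl₁' h7 h7' hmX hΛL h9 h9' t₀ l hl j)) = 0 :=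
  mul_eq_zero_of_weights₅₀ X.toIsog.Φ f hf f'
    (inv_smul_integralHodgeClassesCorrRingHom_pushforward_swapHom_lefschetzFamily_mul_kunnethIdem X hTX eX eXX eT hX0 hgX hcX hgXX hgg₂ hN' hgT f hf f' Θ D hbc₁ hl₁ hl₁' h7 h7'
      hmX hΛL h9 h9' hΘ s₀ k hk hs' i)
    (kunnethIdem_mul_inv_smul_integralHodgeClassesCorrRingHom_pushforward_swapHom_lefschetzFamily X hTX eX eXX eT hX0 hgX hcX hgXX hgg₂ hN' hgT f hf f' Θ D hbc₁ hl₁ hl₁' h7 h7'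
      hmX hΛL h9 h9' hΘ t₀ l hl ht' j) hst

/-- **`e_{s,i} ∘ e′_{t,j} = 0` WHEN THE WEIGHTS `s` AND `2g − t` DIFFER.** [cite: Lange2023AbelianVarietiesComplex, §6.3.4 Prop. 6.3.9–6.3.11 (p0318–p0319)] [cite: Kunnemann1993] -/
theorem inv_smul_integralHodgeClassesCorrRingHom_lefschetzFamily_mul_pushforward_swapHom_of_weight_ne (hΘ : nsDivPower X Θ gX = D • pointIntegralHodgeClass X eX) (s₀ k : ℕ)
    (hk : s₀ + 2 * k ≤ gX + 1) (t₀ l : ℕ) (hl : t₀ + 2 * l ≤ gX + 1) {t' : ℕ} (ht' : (t₀ + 2 * l) + t' = gX + gX) (hst : s₀ + 2 * k ≠ t') (i : Fin (k + 1)) (j : Fin (l + 1)) :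
    (lefschetzFamilyConstant gX D s₀ k : ℚ)⁻¹ • integralHodgeClassesCorrRingHom X hTX eX eXX eT hX0 hgX hcX hgXX hgg₂ hN' hgT f hf f'
          (lefschetzFamily X eX eXX eT hX0 hgX hcX hgXX hgT hN' hgg₂ Θ D hbc₁ hl₁ hl₁' h7 h7' hmX hΛL h9 h9' s₀ k hk i) *
        (lefschetzFamilyConstant gX D t₀ l : ℚ)⁻¹ • integralHodgeClassesCorrRingHom X hTX eX eXX eT hX0 hgX hcX hgXX hgg₂ hN' hgT f hf f'
          (integralHodgeClassesPushforward gX gX (swapHom X X) eXX eXX hcX hgXX hcX hgXX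
            (lefschetzFamily X eX eXX eT hX0 hgX hcX hgXX hgT hN' hgg₂ Θ D hbc₁ hl₁ hl₁' h7 h7' hmX hΛL h9 h9' t₀ l hl j)) = 0 :=
  mul_eq_zero_of_weights₅₀ X.toIsog.Φ f hf f'
    (inv_smul_integralHodgeClassesCorrRingHom_lefschetzFamily_mul_kunnethIdem X hTX eX eXX eT hX0 hgX hcX hgXX hgg₂ hN' hgT f hf f' Θ D hbc₁ hl₁ hl₁' h7 h7' hmX hΛL h9 h9' hΘ s₀ k
      hk i)
    (kunnethIdem_mul_inv_smul_integralHodgeClassesCorrRingHom_pushforward_swapHom_lefschetzFamily X hTX eX eXX eT hX0 hgX hcX hgXX hgg₂ hN' hgT f hf f' Θ D hbc₁ hl₁ hl₁' h7 h7'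
      hmX hΛL h9 h9' hΘ t₀ l hl ht' j) hst

/-- **`e′_{t,j} ∘ e_{s,i} = 0` WHEN THE WEIGHTS `2g − t` AND `s` DIFFER.** [cite: Lange2023AbelianVarietiesComplex, §6.3.4 Prop. 6.3.9–6.3.11 (p0318–p0319)] [cite: Kunnemann1993] -/
theorem inv_smul_integralHodgeClassesCorrRingHom_pushforward_swapHom_mul_lefschetzFamily_of_weight_ne (hΘ : nsDivPower X Θ gX = D • pointIntegralHodgeClass X eX) (s₀ k : ℕ)
    (hk : s₀ + 2 * k ≤ gX + 1) (t₀ l : ℕ) (hl : t₀ + 2 * l ≤ gX + 1) {t' : ℕ} (ht' : (t₀ + 2 * l) + t' = gX + gX) (hst : s₀ + 2 * k ≠ t') (i : Fin (k + 1)) (j : Fin (l + 1)) :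
    (lefschetzFamilyConstant gX D t₀ l : ℚ)⁻¹ • integralHodgeClassesCorrRingHom X hTX eX eXX eT hX0 hgX hcX hgXX hgg₂ hN' hgT f hf f'
          (integralHodgeClassesPushforward gX gX (swapHom X X) eXX eXX hcX hgXX hcX hgXX
            (lefschetzFamily X eX eXX eT hX0 hgX hcX hgXX hgT hN' hgg₂ Θ D hbc₁ hl₁ hl₁' h7 h7' hmX hΛL h9 h9' t₀ l hl j)) *
        (lefschetzFamilyConstant gX D s₀ k : ℚ)⁻¹ • integralHodgeClassesCorrRingHom X hTX eX eXX eT hX0 hgX hcX hgXX hgg₂ hN' hgT f hf f'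
          (lefschetzFamily X eX eXX eT hX0 hgX hcX hgXX hgT hN' hgg₂ Θ D hbc₁ hl₁ hl₁' h7 h7' hmX hΛL h9 h9' s₀ k hk i) = 0 :=
  mul_eq_zero_of_weights₅₀ X.toIsog.Φ f hf f'
    (inv_smul_integralHodgeClassesCorrRingHom_pushforward_swapHom_lefschetzFamily_mul_kunnethIdem X hTX eX eXX eT hX0 hgX hcX hgXX hgg₂ hN' hgT f hf f' Θ D hbc₁ hl₁ hl₁' h7 h7'
      hmX hΛL h9 h9' hΘ t₀ l hl ht' j)
    (kunnethIdem_mul_inv_smul_integralHodgeClassesCorrRingHom_lefschetzFamily X hTX eX eXX eT hX0 hgX hcX hgXX hgg₂ hN' hgT f hf f' Θ D hbc₁ hl₁ hl₁' h7 h7' hmX hΛL h9 h9' hΘ s₀ k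
      hk i) (Ne.symm hst)

/-! ## §2 The middle projectors are symmetric: `ᵗe_{g,i} = e_{g,i}` -/

include hnd in
/-- **KÜNNEMANN's MIDDLE PROJECTORS ARE SYMMETRIC CORRESPONDENCES: `ᵗe_{g,i} = e_{g,i}`** for a tower of weight `s = s₀ + 2k = g` (`N_g ≠ 0`; `i < k`, or `s₀ ≤ 1`) — equivalently
`N_g⁻¹ρ(τ_*p_{g,i}) = N_g⁻¹ρ(p_{g,i})`: a degree-`0` correspondence is determined by its actions on `H•(X, ℂ)` (p08 `endAlgHom_injective`); both act on `Hᵍ(X, ℂ)` as Kleiman's `π_{g,i}`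
(g43-#6 `coact_inv_smul_…`; g44-#2 `coact_inv_smul_…_pushforward_swapHom_…` with `j = g − s = 0`: Kleiman's `ᵗp^{g,i} = p^{g, i}`) and as `0` on the other degrees (weights `g = 2g − g`).
[cite: Milne1999LefschetzClasses, §5 p. 664 (p0026 L42–L50) and Thm. 5.9] [cite: Kleiman1968AlgebraicCycles, §1.4, 1.4.4] [cite: Lange2023AbelianVarietiesComplex, §6.3.4 Prop. 6.3.10 (p0318)]
[cite: Fulton1998, §16.1 Prop. 16.1.2 (b) and Example 16.1.15 (p0302 L27–L40)] [cite: Kunnemann1993] -/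
theorem inv_smul_integralHodgeClassesCorrRingHom_pushforward_swapHom_lefschetzFamily_of_weight_eq (hΘ : nsDivPower X Θ gX = D • pointIntegralHodgeClass X eX) (s₀ k : ℕ)
    (hk : s₀ + 2 * k ≤ gX + 1) (hs : s₀ + 2 * k = gX) (hN : lefschetzFamilyConstant gX D s₀ k ≠ 0) (i : Fin (k + 1)) (hi : (i : ℕ) < k ∨ s₀ ≤ 1) :
    (lefschetzFamilyConstant gX D s₀ k : ℚ)⁻¹ • integralHodgeClassesCorrRingHom X hTX eX eXX eT hX0 hgX hcX hgXX hgg₂ hN' hgT f hf f'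
        (integralHodgeClassesPushforward gX gX (swapHom X X) eXX eXX hcX hgXX hcX hgXX
          (lefschetzFamily X eX eXX eT hX0 hgX hcX hgXX hgT hN' hgg₂ Θ D hbc₁ hl₁ hl₁' h7 h7' hmX hΛL h9 h9' s₀ k hk i)) =
      (lefschetzFamilyConstant gX D s₀ k : ℚ)⁻¹ • integralHodgeClassesCorrRingHom X hTX eX eXX eT hX0 hgX hcX hgXX hgg₂ hN' hgT f hf f'
        (lefschetzFamily X eX eXX eT hX0 hgX hcX hgXX hgT hN' hgg₂ Θ D hbc₁ hl₁ hl₁' h7 h7' hmX hΛL h9 h9' s₀ k hk i) := by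
  refine CorrRing.endAlgHom_injective X.toIsog.Φ f hf f' (funext fun d ↦ ?_)
  obtain ⟨d, hd⟩ := d
  rw [CorrRing.endAlgHom_apply, CorrRing.endAlgHom_apply]
  dsimp only
  by_cases hds : d = s₀ + 2 * k
  · subst hds
    rw [coact_inv_smul_integralHodgeClassesCorrRingHom_pushforward_swapHom_lefschetzFamily X hTX eX eXX eT hX0 hgX hcX hgXX hgg₂ hN' hgT f hf f' Θ D hbc₁ hl₁ hl₁' h7 h7' hmX hΛL
        h9 h9' hnd hΘ s₀ k hk hN (j := 0) (s' := s₀ + 2 * k) (by omega) (by omega) _ i hi, Nat.zero_add,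
      coact_inv_smul_integralHodgeClassesCorrRingHom_lefschetzFamily X hTX eX eXX eT hX0 hgX hcX hgXX hgg₂ hN' hgT f hf f' Θ D hbc₁ hl₁ hl₁' h7 h7' hmX hΛL h9 h9' hnd hΘ s₀ k hk
        (by omega) _ hN i hi]
  · rw [coact_inv_smul_integralHodgeClassesCorrRingHom_pushforward_swapHom_lefschetzFamily_of_ne X hTX eX eXX eT hX0 hgX hcX hgXX hgg₂ hN' hgT f hf f' Θ D hbc₁ hl₁ hl₁' h7 h7' hmX
        hΛL h9 h9' hΘ s₀ k hk (t := s₀ + 2 * k) (by omega) i _ hds,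
      coact_inv_smul_integralHodgeClassesCorrRingHom_lefschetzFamily_of_ne X hTX eX eXX eT hX0 hgX hcX hgXX hgg₂ hN' hgT f hf f' Θ D hbc₁ hl₁ hl₁' h7 h7' hmX hΛL h9 h9' hΘ s₀ k hk i _
        hds]

include hnd in
/-- **… i.e. `ᵗ(e_{g,i}) = e_{g,i}`: the idempotents of the middle motive `hᵍ(X)` are fixed by the transpose involution of p08's algebra.** [cite: Milne1999LefschetzClasses, §5 p. 664 (p0026 L42–L50) and Thm. 5.9]
[cite: Lange2023AbelianVarietiesComplex, §6.3.4 Prop. 6.3.10 (p0318) and §6.2.2 p. 304] [cite: Kunnemann1993] -/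
theorem transpose_inv_smul_integralHodgeClassesCorrRingHom_lefschetzFamily_of_weight_eq (hΘ : nsDivPower X Θ gX = D • pointIntegralHodgeClass X eX) (s₀ k : ℕ)
    (hk : s₀ + 2 * k ≤ gX + 1) (hs : s₀ + 2 * k = gX) (hN : lefschetzFamilyConstant gX D s₀ k ≠ 0) (i : Fin (k + 1)) (hi : (i : ℕ) < k ∨ s₀ ≤ 1) :
    CorrRing.transpose X.toIsog.Φ f hf f' ((lefschetzFamilyConstant gX D s₀ k : ℚ)⁻¹ • integralHodgeClassesCorrRingHom X hTX eX eXX eT hX0 hgX hcX hgXX hgg₂ hN' hgT f hf f'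
        (lefschetzFamily X eX eXX eT hX0 hgX hcX hgXX hgT hN' hgg₂ Θ D hbc₁ hl₁ hl₁' h7 h7' hmX hΛL h9 h9' s₀ k hk i)) =
      (lefschetzFamilyConstant gX D s₀ k : ℚ)⁻¹ • integralHodgeClassesCorrRingHom X hTX eX eXX eT hX0 hgX hcX hgXX hgg₂ hN' hgT f hf f'
        (lefschetzFamily X eX eXX eT hX0 hgX hcX hgXX hgT hN' hgg₂ Θ D hbc₁ hl₁ hl₁' h7 h7' hmX hΛL h9 h9' s₀ k hk i) := by
  rw [← inv_smul_integralHodgeClassesCorrRingHom_pushforward_swapHom_lefschetzFamily]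
  exact inv_smul_integralHodgeClassesCorrRingHom_pushforward_swapHom_lefschetzFamily_of_weight_eq X hTX eX eXX eT hX0 hgX hcX hgXX hgg₂ hN' hgT f hf f' Θ D hbc₁ hl₁ hl₁' h7 h7' hmX
    hΛL h9 h9' hnd hΘ s₀ k hk hs hN i hi

/-! ## §3 The full family and its linear independence -/

/-- **KÜNNEMANN's FULL FAMILY OF IDEMPOTENTS OF `h(X)`**, indexed by `KunnemannIndex g`: for a weight `s ≤ g` and `i ≤ ⌊s/2⌋` the idempotent `e_{s,i}` of the complete tower
`s = (s mod 2) + 2⌊s/2⌋`; for a co-weight `t < g` and `i ≤ ⌊t/2⌋` the transposed idempotent `e′_{t,i}` of weight `2g − t`. Together they refine `1 = Σ_s π_s` (Künnemann / Murre §7.18).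
[cite: Milne1999LefschetzClasses, §5 p. 664 (p0026 L42–L50)] [cite: Kunnemann1993] [cite: GreenMurreVoisin1994, Murre §7.18 (3) (p0128 L9)] -/
abbrev kunnemannFamily : KunnemannIndex gX → CorrRing X.toIsog.Φ f hf f'
  | Sum.inl ⟨s, i⟩ => (lefschetzFamilyConstant gX D ((s : ℕ) % 2) ((s : ℕ) / 2) : ℚ)⁻¹ • integralHodgeClassesCorrRingHom X hTX eX eXX eT hX0 hgX hcX hgXX hgg₂ hN' hgT f hf f'
      (lefschetzFamily X eX eXX eT hX0 hgX hcX hgXX hgT hN' hgg₂ Θ D hbc₁ hl₁ hl₁' h7 h7' hmX hΛL h9 h9' ((s : ℕ) % 2) ((s : ℕ) / 2)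
        (by have := Nat.mod_add_div (s : ℕ) 2; have := s.2; omega) i)
  | Sum.inr ⟨t, i⟩ => (lefschetzFamilyConstant gX D ((t : ℕ) % 2) ((t : ℕ) / 2) : ℚ)⁻¹ • integralHodgeClassesCorrRingHom X hTX eX eXX eT hX0 hgX hcX hgXX hgg₂ hN' hgT f hf f'
      (integralHodgeClassesPushforward gX gX (swapHom X X) eXX eXX hcX hgXX hcX hgXX
        (lefschetzFamily X eX eXX eT hX0 hgX hcX hgXX hgT hN' hgg₂ Θ D hbc₁ hl₁ hl₁' h7 h7' hmX hΛL h9 h9' ((t : ℕ) % 2) ((t : ℕ) / 2)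
          (by have := Nat.mod_add_div (t : ℕ) 2; have := t.2; omega) i))

/-- Every member of the full family is an idempotent (`N_s ≠ 0` for all `s`). [cite: Kunnemann1993] [cite: Kahn2020, App. A Thm. A.6 (p0135)] -/
theorem isIdempotentElem_kunnemannFamily (hΘ : nsDivPower X Θ gX = D • pointIntegralHodgeClass X eX) (hN : ∀ s₀ k, s₀ + 2 * k ≤ gX + 1 → lefschetzFamilyConstant gX D s₀ k ≠ 0)
    (a : KunnemannIndex gX) :
    IsIdempotentElem (kunnemannFamily X hTX eX eXX eT hX0 hgX hcX hgXX hgg₂ hN' hgT f hf f' Θ D hbc₁ hl₁ hl₁' h7 h7' hmX hΛL h9 h9' a) := by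
  rcases a with ⟨s, i⟩ | ⟨t, i⟩
  · have hks : (s : ℕ) % 2 + 2 * ((s : ℕ) / 2) ≤ gX + 1 := by have := Nat.mod_add_div (s : ℕ) 2; have := s.2; omega
    exact isIdempotentElem_inv_smul_integralHodgeClassesCorrRingHom_lefschetzFamily X hTX eX eXX eT hX0 hgX hcX hgXX hgg₂ hN' hgT f hf f' Θ D hbc₁ hl₁ hl₁' h7 h7' hmX hΛL h9 h9' hΘ
      _ _ hks (hN _ _ hks) i
  · have hkt : (t : ℕ) % 2 + 2 * ((t : ℕ) / 2) ≤ gX + 1 := by have := Nat.mod_add_div (t : ℕ) 2; have := t.2; omega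
    exact isIdempotentElem_inv_smul_integralHodgeClassesCorrRingHom_pushforward_swapHom_lefschetzFamily X hTX eX eXX eT hX0 hgX hcX hgXX hgg₂ hN' hgT f hf f' Θ D hbc₁ hl₁ hl₁' h7
      h7' hmX hΛL h9 h9' hΘ _ _ hkt (hN _ _ hkt) i

include hnd in
/-- Every member of the full family is non-zero (`N_s ≠ 0`; g44-#2 §1–§2). [cite: Milne1999LefschetzClasses, §5 p. 664 (p0026 L42–L50)] [cite: Kunnemann1993] -/
theorem kunnemannFamily_ne_zero (hΘ : nsDivPower X Θ gX = D • pointIntegralHodgeClass X eX) (hN : ∀ s₀ k, s₀ + 2 * k ≤ gX + 1 → lefschetzFamilyConstant gX D s₀ k ≠ 0)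
    (a : KunnemannIndex gX) :
    kunnemannFamily X hTX eX eXX eT hX0 hgX hcX hgXX hgg₂ hN' hgT f hf f' Θ D hbc₁ hl₁ hl₁' h7 h7' hmX hΛL h9 h9' a ≠ 0 := by
  rcases a with ⟨s, i⟩ | ⟨t, i⟩
  · have hks : (s : ℕ) % 2 + 2 * ((s : ℕ) / 2) ≤ gX + 1 := by have := Nat.mod_add_div (s : ℕ) 2; have := s.2; omega
    exact inv_smul_integralHodgeClassesCorrRingHom_lefschetzFamily_ne_zero X hTX eX eXX eT hX0 hgX hcX hgXX hgg₂ hN' hgT f hf f' Θ D hbc₁ hl₁ hl₁' h7 h7' hmX hΛL h9 h9' hnd hΘ _ _ hks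
      (by have := Nat.mod_add_div (s : ℕ) 2; have := s.2; omega) (hN _ _ hks) i (Or.inr (by omega))
  · have hkt : (t : ℕ) % 2 + 2 * ((t : ℕ) / 2) ≤ gX + 1 := by have := Nat.mod_add_div (t : ℕ) 2; have := t.2; omega
    exact inv_smul_integralHodgeClassesCorrRingHom_pushforward_swapHom_lefschetzFamily_ne_zero X hTX eX eXX eT hX0 hgX hcX hgXX hgg₂ hN' hgT f hf f' Θ D hbc₁ hl₁ hl₁' h7 h7' hmX
      hΛL h9 h9' hnd hΘ _ _ hkt (by have := Nat.mod_add_div (t : ℕ) 2; have := t.2; omega) (hN _ _ hkt) i (Or.inr (by omega))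

/-- **Distinct members of the full family are orthogonal** — within a tower (g43-#6, g44-#2) and across weights (§1; the weights of `e_{s,·}` are `≤ g`, those of `e′_{t,·}` are `> g`).
[cite: Lange2023AbelianVarietiesComplex, §6.3.4 Prop. 6.3.9–6.3.11 (p0318–p0319)] [cite: Milne1999LefschetzClasses, §5 p. 664 (p0026 L42–L50)] [cite: Kunnemann1993] -/
theorem kunnemannFamily_mul_of_ne (hΘ : nsDivPower X Θ gX = D • pointIntegralHodgeClass X eX) {a b : KunnemannIndex gX} (hab : a ≠ b) :
    kunnemannFamily X hTX eX eXX eT hX0 hgX hcX hgXX hgg₂ hN' hgT f hf f' Θ D hbc₁ hl₁ hl₁' h7 h7' hmX hΛL h9 h9' a *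
      kunnemannFamily X hTX eX eXX eT hX0 hgX hcX hgXX hgg₂ hN' hgT f hf f' Θ D hbc₁ hl₁ hl₁' h7 h7' hmX hΛL h9 h9' b = 0 := by
  rcases a with ⟨s, i⟩ | ⟨t, i⟩ <;> rcases b with ⟨s', j⟩ | ⟨t', j⟩
  · by_cases hss : s = s'
    · subst hss
      have hij : i ≠ j := fun h ↦ hab (by subst h; rfl)
      exact inv_smul_integralHodgeClassesCorrRingHom_lefschetzFamily_mul_of_ne X hTX eX eXX eT hX0 hgX hcX hgXX hgg₂ hN' hgT f hf f' Θ D hbc₁ hl₁ hl₁' h7 h7' hmX hΛL h9 h9' hΘ _ _ _ hij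
    · have hne : (s : ℕ) ≠ s' := fun h ↦ hss (Fin.ext h)
      exact inv_smul_integralHodgeClassesCorrRingHom_lefschetzFamily_mul_of_weight_ne X hTX eX eXX eT hX0 hgX hcX hgXX hgg₂ hN' hgT f hf f' Θ D hbc₁ hl₁ hl₁' h7 h7' hmX hΛL h9 h9' hΘ
        _ _ _ _ _ _ (by have := Nat.mod_add_div (s : ℕ) 2; have := Nat.mod_add_div (s' : ℕ) 2; omega) i j
  · exact inv_smul_integralHodgeClassesCorrRingHom_lefschetzFamily_mul_pushforward_swapHom_of_weight_ne X hTX eX eXX eT hX0 hgX hcX hgXX hgg₂ hN' hgT f hf f' Θ D hbc₁ hl₁ hl₁' h7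
      h7' hmX hΛL h9 h9' hΘ _ _ _ _ _ _ (t' := gX + gX - ((t' : ℕ) % 2 + 2 * ((t' : ℕ) / 2))) (by have := Nat.mod_add_div (t' : ℕ) 2; have := t'.2; omega)
      (by have := Nat.mod_add_div (s : ℕ) 2; have := Nat.mod_add_div (t' : ℕ) 2; have := s.2; have := t'.2; omega) i j
  · exact inv_smul_integralHodgeClassesCorrRingHom_pushforward_swapHom_mul_lefschetzFamily_of_weight_ne X hTX eX eXX eT hX0 hgX hcX hgXX hgg₂ hN' hgT f hf f' Θ D hbc₁ hl₁ hl₁' h7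
      h7' hmX hΛL h9 h9' hΘ _ _ _ _ _ _ (t' := gX + gX - ((t : ℕ) % 2 + 2 * ((t : ℕ) / 2))) (by have := Nat.mod_add_div (t : ℕ) 2; have := t.2; omega)
      (by have := Nat.mod_add_div (s' : ℕ) 2; have := Nat.mod_add_div (t : ℕ) 2; have := s'.2; have := t.2; omega) j i
  · by_cases htt : t = t'
    · subst htt
      have hij : i ≠ j := fun h ↦ hab (by subst h; rfl)
      exact inv_smul_integralHodgeClassesCorrRingHom_pushforward_swapHom_lefschetzFamily_mul_of_ne X hTX eX eXX eT hX0 hgX hcX hgXX hgg₂ hN' hgT f hf f' Θ D hbc₁ hl₁ hl₁' h7 h7'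
        hmX hΛL h9 h9' hΘ _ _ _ hij
    · have hne : (t : ℕ) ≠ t' := fun h ↦ htt (Fin.ext h)
      exact inv_smul_integralHodgeClassesCorrRingHom_pushforward_swapHom_lefschetzFamily_mul_of_weight_ne X hTX eX eXX eT hX0 hgX hcX hgXX hgg₂ hN' hgT f hf f' Θ D hbc₁ hl₁ hl₁'
        h7 h7' hmX hΛL h9 h9' hΘ _ _ _ (s' := gX + gX - ((t : ℕ) % 2 + 2 * ((t : ℕ) / 2))) (by have := Nat.mod_add_div (t : ℕ) 2; have := t.2; omega) _ _ _
        (t' := gX + gX - ((t' : ℕ) % 2 + 2 * ((t' : ℕ) / 2))) (by have := Nat.mod_add_div (t' : ℕ) 2; have := t'.2; omega)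
        (by have := Nat.mod_add_div (t : ℕ) 2; have := Nat.mod_add_div (t' : ℕ) 2; have := t.2; have := t'.2; omega) i j

include hnd in
/-- **THE FULL FAMILY OF KÜNNEMANN IDEMPOTENTS IS `ℚ`-LINEARLY INDEPENDENT IN p08's ALGEBRA OF CORRESPONDENCES** (pairwise orthogonal non-zero idempotents; `Θ` non-degenerate with
`Θ^{[g]} = D·[pt]`, all `N_s ≠ 0`). [cite: Milne1999LefschetzClasses, §5 p. 664 (p0026 L42–L50)] [cite: Lange2023AbelianVarietiesComplex, §6.3.4 Prop. 6.3.9–6.3.11 (p0318–p0319)] [cite: Kunnemann1993] -/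
theorem linearIndependent_kunnemannFamily (hΘ : nsDivPower X Θ gX = D • pointIntegralHodgeClass X eX) (hN : ∀ s₀ k, s₀ + 2 * k ≤ gX + 1 → lefschetzFamilyConstant gX D s₀ k ≠ 0) :
    LinearIndependent ℚ (kunnemannFamily X hTX eX eXX eT hX0 hgX hcX hgXX hgg₂ hN' hgT f hf f' Θ D hbc₁ hl₁ hl₁' h7 h7' hmX hΛL h9 h9') :=
  linearIndependent_of_isIdempotentElem_of_mul_eq_zero _
    (isIdempotentElem_kunnemannFamily X hTX eX eXX eT hX0 hgX hcX hgXX hgg₂ hN' hgT f hf f' Θ D hbc₁ hl₁ hl₁' h7 h7' hmX hΛL h9 h9' hΘ hN)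
    (fun _ _ hab ↦ kunnemannFamily_mul_of_ne X hTX eX eXX eT hX0 hgX hcX hgXX hgg₂ hN' hgT f hf f' Θ D hbc₁ hl₁ hl₁' h7 h7' hmX hΛL h9 h9' hΘ hab)
    (kunnemannFamily_ne_zero X hTX eX eXX eT hX0 hgX hcX hgXX hgg₂ hN' hgT f hf f' Θ D hbc₁ hl₁ hl₁' h7 h7' hmX hΛL h9 h9' hnd hΘ hN)

/-- Every member of the full family is a Hodge correspondence. [cite: Lange2023AbelianVarietiesComplex, §6.2.1 Lemma 6.2.7 and §7.2.2] -/
theorem kunnemannFamily_mem_hodgeCorr (a : KunnemannIndex gX) :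
    kunnemannFamily X hTX eX eXX eT hX0 hgX hcX hgXX hgg₂ hN' hgT f hf f' Θ D hbc₁ hl₁ hl₁' h7 h7' hmX hΛL h9 h9' a ∈ CorrRing.hodgeCorr X.toIsog.Φ f hf f' := by
  rcases a with ⟨s, i⟩ | ⟨t, i⟩
  · exact inv_smul_integralHodgeClassesCorrRingHom_lefschetzFamily_mem_hodgeCorr X hTX eX eXX eT hX0 hgX hcX hgXX hgg₂ hN' hgT f hf f' Θ D hbc₁ hl₁ hl₁' h7 h7' hmX hΛL h9 h9' _ _ _ i
  · exact inv_smul_integralHodgeClassesCorrRingHom_pushforward_swapHom_lefschetzFamily_mem_hodgeCorr X hTX eX eXX eT hX0 hgX hcX hgXX hgg₂ hN' hgT f hf f' Θ D hbc₁ hl₁ hl₁' h7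
      h7' hmX hΛL h9 h9' _ _ _ i

/-- Every member of the full family is a Lefschetz correspondence (polarized torus). [cite: Milne1999LefschetzClasses, §5 Thm. 5.9 (p0026 L74 – p0027 L9) and Cor. 5.8] -/
theorem kunnemannFamily_mem_lefschetzCorr {η : X.toIsog.E [⋀^Fin 2]→L[ℝ] ℝ} (hη : IsRiemannForm X.toIsog.Φ η) (hg1 : gX + 1 = c₁) (a : KunnemannIndex gX) :
    kunnemannFamily X hTX eX eXX eT hX0 hgX hcX hgXX hgg₂ hN' hgT f hf f' Θ D hbc₁ hl₁ hl₁' h7 h7' hmX hΛL h9 h9' a ∈ CorrRing.lefschetzCorr X.toIsog.Φ f hf f' hη := by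
  rcases a with ⟨s, i⟩ | ⟨t, i⟩
  · exact inv_smul_integralHodgeClassesCorrRingHom_lefschetzFamily_mem_lefschetzCorr X hTX eX eXX eT hX0 hgX hcX hgXX hgg₂ hN' hgT f hf f' Θ D hbc₁ hl₁ hl₁' h7 h7' hmX hΛL h9 h9' hη
      hg1 _ _ _ i
  · exact inv_smul_integralHodgeClassesCorrRingHom_pushforward_swapHom_lefschetzFamily_mem_lefschetzCorr X hTX eX eXX eT hX0 hgX hcX hgXX hgg₂ hN' hgT f hf f' Θ D hbc₁ hl₁ hl₁'
      h7 h7' hmX hΛL h9 h9' hη hg1 _ _ _ i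

include hnd in
/-- **… LINEARLY INDEPENDENT IN `Bᵍ(X × X)`.** [cite: Lange2023AbelianVarietiesComplex, §7.2.2 and §6.3.4 Prop. 6.3.9–6.3.11] [cite: Kunnemann1993] -/
theorem linearIndependent_kunnemannFamily_hodgeCorr (hΘ : nsDivPower X Θ gX = D • pointIntegralHodgeClass X eX)
    (hN : ∀ s₀ k, s₀ + 2 * k ≤ gX + 1 → lefschetzFamilyConstant gX D s₀ k ≠ 0) :
    LinearIndependent ℚ fun a ↦ (⟨kunnemannFamily X hTX eX eXX eT hX0 hgX hcX hgXX hgg₂ hN' hgT f hf f' Θ D hbc₁ hl₁ hl₁' h7 h7' hmX hΛL h9 h9' a,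
      kunnemannFamily_mem_hodgeCorr X hTX eX eXX eT hX0 hgX hcX hgXX hgg₂ hN' hgT f hf f' Θ D hbc₁ hl₁ hl₁' h7 h7' hmX hΛL h9 h9' a⟩ : CorrRing.hodgeCorr X.toIsog.Φ f hf f') :=
  linearIndependent_subalgebra₅₀ X.toIsog.Φ f hf f' _ _
    (linearIndependent_kunnemannFamily X hTX eX eXX eT hX0 hgX hcX hgXX hgg₂ hN' hgT f hf f' Θ D hbc₁ hl₁ hl₁' h7 h7' hmX hΛL h9 h9' hnd hΘ hN)

include hnd in
/-- **… LINEARLY INDEPENDENT IN `Dᵍ(X × X)`** (polarized torus). [cite: Milne1999LefschetzClasses, §5 Thm. 5.9 and Cor. 5.8] [cite: Kunnemann1993] -/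
theorem linearIndependent_kunnemannFamily_lefschetzCorr {η : X.toIsog.E [⋀^Fin 2]→L[ℝ] ℝ} (hη : IsRiemannForm X.toIsog.Φ η) (hg1 : gX + 1 = c₁)
    (hΘ : nsDivPower X Θ gX = D • pointIntegralHodgeClass X eX) (hN : ∀ s₀ k, s₀ + 2 * k ≤ gX + 1 → lefschetzFamilyConstant gX D s₀ k ≠ 0) :
    LinearIndependent ℚ fun a ↦ (⟨kunnemannFamily X hTX eX eXX eT hX0 hgX hcX hgXX hgg₂ hN' hgT f hf f' Θ D hbc₁ hl₁ hl₁' h7 h7' hmX hΛL h9 h9' a,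
      kunnemannFamily_mem_lefschetzCorr X hTX eX eXX eT hX0 hgX hcX hgXX hgg₂ hN' hgT f hf f' Θ D hbc₁ hl₁ hl₁' h7 h7' hmX hΛL h9 h9' hη hg1 a⟩ :
        CorrRing.lefschetzCorr X.toIsog.Φ f hf f' hη) :=
  linearIndependent_subalgebra₅₀ X.toIsog.Φ f hf f' _ _
    (linearIndependent_kunnemannFamily X hTX eX eXX eT hX0 hgX hcX hgXX hgg₂ hN' hgT f hf f' Θ D hbc₁ hl₁ hl₁' h7 h7' hmX hΛL h9 h9' hnd hΘ hN)

include hTX eX eXX eT hX0 hgX hcX hgXX hgg₂ hN' hgT Θ D hbc₁ hl₁ hl₁' h7 h7' hmX hΛL h9 h9' hnd in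
/-- **`dim_ℚ Bᵍ(X × X) ≥ #KunnemannIndex g = Σ_{s=0}^{2g} (⌊min(s, 2g−s)/2⌋ + 1)`** for a complex torus with `Θ` non-degenerate, `Θ^{[g]} = D·[pt]`, all `N_s ≠ 0` (`Bᵍ(X × X)` is
finite-dimensional over `ℚ`, p08). [cite: Lange2023AbelianVarietiesComplex, §7.2.2 and §6.3.4 Prop. 6.3.9–6.3.11 (p0318–p0319)] [cite: Milne1999LefschetzClasses, §5 p. 664 (p0026 L42–L50)] [cite: Kunnemann1993] -/
theorem card_kunnemannIndex_le_finrank_hodgeCorr_of_nsDivPower_eq (hΘ : nsDivPower X Θ gX = D • pointIntegralHodgeClass X eX)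
    (hN : ∀ s₀ k, s₀ + 2 * k ≤ gX + 1 → lefschetzFamilyConstant gX D s₀ k ≠ 0) :
    Fintype.card (KunnemannIndex gX) ≤ Module.finrank ℚ (CorrRing.hodgeCorr X.toIsog.Φ f hf f') :=
  (linearIndependent_kunnemannFamily_hodgeCorr X hTX eX eXX eT hX0 hgX hcX hgXX hgg₂ hN' hgT f hf f' Θ D hbc₁ hl₁ hl₁' h7 h7' hmX hΛL h9 h9' hnd hΘ hN).fintype_card_le_finrank

include hTX eX eXX eT hX0 hgX hcX hgXX hgg₂ hN' hgT Θ D hbc₁ hl₁ hl₁' h7 h7' hmX hΛL h9 h9' hnd in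
/-- **`dim_ℚ Dᵍ(X × X) ≥ #KunnemannIndex g`** for a polarized complex torus carrying such a `Θ` (`Dᵍ(X × X)` is finite-dimensional over `ℚ`, p08).
[cite: Milne1999LefschetzClasses, §5 p. 664 (p0026 L42–L50), Thm. 5.9 and Cor. 5.8] [cite: Kunnemann1993] -/
theorem card_kunnemannIndex_le_finrank_lefschetzCorr_of_nsDivPower_eq {η : X.toIsog.E [⋀^Fin 2]→L[ℝ] ℝ} (hη : IsRiemannForm X.toIsog.Φ η) (hg1 : gX + 1 = c₁)
    (hΘ : nsDivPower X Θ gX = D • pointIntegralHodgeClass X eX) (hN : ∀ s₀ k, s₀ + 2 * k ≤ gX + 1 → lefschetzFamilyConstant gX D s₀ k ≠ 0) :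
    Fintype.card (KunnemannIndex gX) ≤ Module.finrank ℚ (CorrRing.lefschetzCorr X.toIsog.Φ f hf f' hη) := by
  haveI := CorrRing.finiteDimensional_lefschetzCorr X.toIsog.Φ f hf f' hη
  exact (linearIndependent_kunnemannFamily_lefschetzCorr X hTX eX eXX eT hX0 hgX hcX hgXX hgg₂ hN' hgT f hf f' Θ D hbc₁ hl₁ hl₁' h7 h7' hmX hΛL h9 h9' hnd hη hg1 hΘ
    hN).fintype_card_le_finrank

end Kunnemann

/-! ## §4 Polarized complex tori of type `(d₁, …, d_g)`: `dim_ℚ Bᵍ(X × X), dim_ℚ Dᵍ(X × X) ≥ Σ_{s=0}^{2g} (⌊min(s, 2g−s)/2⌋ + 1)` -/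

section Polarized

/-- The Tower's codegrees for the frames `X × X`, `X × (X × X)` built from the ring frame (`g = b + 1`), with `hTX`. [folklore] -/
private theorem tower_degrees₅₀ {gX b : ℕ} (hb : gX = b + 1) :
    (gX + gX) + gX = gX + (gX + gX) ∧ 2 * gX + 2 * 0 = 2 * gX ∧ gX + gX = 2 * gX ∧ 2 * gX + 2 * gX = 2 * (gX + gX) ∧ (gX + gX) + (gX + gX) = 2 * (gX + gX) ∧
      gX + gX = gX + gX ∧ 2 * gX + 2 * (gX + gX) = 2 * (gX + (gX + gX)) ∧ (gX + (gX + gX)) + (gX + (gX + gX)) = 2 * (gX + (gX + gX)) ∧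
      (gX + b) + 1 = gX + gX ∧ 2 * b + 2 * 1 = 2 * gX ∧ 2 * b + 2 * (gX + 1) = 2 * (gX + gX) ∧ (2 * gX + 2) + 2 * (gX + b) = 2 * (gX + (gX + gX)) ∧
      (2 * gX + 2) + 2 * b = 2 * (gX + gX) ∧ b + gX = gX + b ∧ b + (gX + 1) = gX + b + 1 ∧ 2 * gX + 2 * (gX + b + 1) = 2 * (gX + (gX + gX)) ∧
      2 * gX + 2 * gX = 2 * (gX + gX) := by
  omega

variable (X : ComplexTorusCat) {gX : ℕ} (f : Fin (gX + gX) ≃ X.toIsog.ι) (hf : orientationSign X.toIsog.Φ f = 1) (f' : Fin ((gX + gX) + (gX + gX)) ≃ X.toIsog.ι ⊕ X.toIsog.ι)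
  {θ : neronSeveriGroup X.toIsog.Φ} (hθ : IsRiemannForm X.toIsog.Φ (θ : X.toIsog.E [⋀^Fin 2]→L[ℝ] ℝ))
  {dd : Fin gX → ℕ} (hd : IsPolarizationType X.toIsog.Φ (θ : X.toIsog.E [⋀^Fin 2]→L[ℝ] ℝ) dd)

include hθ hd in
/-- `(−1)^g d₁⋯d_g ≠ 0` for a polarization of type `(d₁, …, d_g)`. [cite: Lange2023AbelianVarietiesComplex, §3.6 Thm. 3.6.1] -/
private theorem neg_one_pow_mul_prod_ne_zero₅₀ : ((-1 : ℤ) ^ gX * ∏ j, (dd j : ℤ)) ≠ 0 :=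
  mul_ne_zero (pow_ne_zero _ (by norm_num)) (Finset.prod_ne_zero_iff.2 fun j _ ↦ Int.natCast_ne_zero.2 (hd.pos hθ j).ne')

include hθ hd in
/-- **ON A POLARIZED COMPLEX TORUS `(X, θ)` OF TYPE `(d₁, …, d_g)` — IN PARTICULAR ON EVERY POLARIZED ABELIAN VARIETY: `dim_ℚ Bᵍ(X × X) ≥ Σ_{s=0}^{2g} (⌊min(s, 2g−s)/2⌋ + 1)`**
(`= #KunnemannIndex g`, `card_kunnemannIndex`; the towers built from `θ`, `N_s ≠ 0` unconditionally; only the ring frame `(f, f′)` of p08's algebra in the statement).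
[cite: Lange2023AbelianVarietiesComplex, §3.6 Thm. 3.6.1, §7.2.2 and §6.3.4 Prop. 6.3.9–6.3.11 (p0318–p0319)] [cite: Milne1999LefschetzClasses, §5 p. 664 (p0026 L42–L50)] [cite: Kunnemann1993] -/
theorem sum_le_finrank_hodgeCorr : ∑ s : Fin (gX + gX + 1), (min (s : ℕ) (gX + gX - s) / 2 + 1) ≤ Module.finrank ℚ (CorrRing.hodgeCorr X.toIsog.Φ f hf f') := by
  rw [← card_kunnemannIndex]
  -- the degenerate torus `g = 0`: one index, and `Bᵍ ∋ 1 ≠ 0`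
  rcases Nat.eq_zero_or_pos gX with hg0 | hg0
  · subst hg0
    have hcard : Fintype.card (KunnemannIndex 0) = 1 := by rw [card_kunnemannIndex_eq_add]; simp
    rw [hcard]
    refine Module.finrank_pos_iff_exists_ne_zero.2 ⟨1, fun h ↦ CorrRing.kunnethIdem_ne_zero X.toIsog.Φ f hf f' ⟨0, by omega⟩ ?_⟩
    have h1 : (1 : CorrRing X.toIsog.Φ f hf f') = 0 := congrArg Subtype.val h
    rw [← mul_one (CorrRing.kunnethIdem X.toIsog.Φ f hf f' _), h1, mul_zero]
  obtain ⟨b, hb⟩ : ∃ b, gX = b + 1 := ⟨gX - 1, by omega⟩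
  obtain ⟨hTX, hX0, hgX, hcX, hgXX, hgg₂, hN', hgT, hbc₁, hl₁, hl₁', h7, h7', hmX, hΛL, h9, h9'⟩ := tower_degrees₅₀ hb
  let eX : Fin (2 * gX) ≃ X.toIsog.ι := (finCongr (two_mul gX)).trans f
  let eXX : Fin (2 * (gX + gX)) ≃ (prodObj X X).toIsog.ι := (finCongr hcX.symm).trans (finSumFinEquiv.symm.trans (eX.sumCongr eX))
  let eT : Fin (2 * (gX + (gX + gX))) ≃ (prodObj X (prodObj X X)).toIsog.ι := (finCongr hN'.symm).trans (finSumFinEquiv.symm.trans (eX.sumCongr eXX))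
  exact card_kunnemannIndex_le_finrank_hodgeCorr_of_nsDivPower_eq X hTX eX eXX eT hX0 hgX hcX hgXX hgg₂ hN' hgT f hf f' θ _ hbc₁ hl₁ hl₁' h7 h7' hmX hΛL h9 h9'
    (IsRiemannForm.exists_apply_ne_zero X.toIsog.Φ hθ) (nsDivPower_top_eq_zsmul_pointIntegralHodgeClass X eX hθ hd)
    (fun s₀ k hk ↦ lefschetzFamilyConstant_ne_zero (neg_one_pow_mul_prod_ne_zero₅₀ X hθ hd) s₀ k hk)

include hθ hd in
/-- **ON A POLARIZED COMPLEX TORUS OF TYPE `(d₁, …, d_g)`: `dim_ℚ Dᵍ(X × X) ≥ Σ_{s=0}^{2g} (⌊min(s, 2g−s)/2⌋ + 1)`** — the algebra of degree-`0` Lefschetz correspondences (Milne's `Dᵍ(X × X)`,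
semisimple by Cor. 5.3) has at least `3, 6, 10, 15, …` dimensions for `g = 1, 2, 3, 4, …`; equality holds for a Lefschetz-generic abelian variety (not proved here).
[cite: Milne1999LefschetzClasses, §5 p. 664 (p0026 L42–L50), Thm. 5.9 and Cor. 5.3] [cite: Lange2023AbelianVarietiesComplex, §3.6 Thm. 3.6.1] [cite: Kunnemann1993] -/
theorem sum_le_finrank_lefschetzCorr : ∑ s : Fin (gX + gX + 1), (min (s : ℕ) (gX + gX - s) / 2 + 1) ≤ Module.finrank ℚ (CorrRing.lefschetzCorr X.toIsog.Φ f hf f' hθ) := by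
  haveI := CorrRing.finiteDimensional_lefschetzCorr X.toIsog.Φ f hf f' hθ
  rw [← card_kunnemannIndex]
  rcases Nat.eq_zero_or_pos gX with hg0 | hg0
  · subst hg0
    have hcard : Fintype.card (KunnemannIndex 0) = 1 := by rw [card_kunnemannIndex_eq_add]; simp
    rw [hcard]
    refine Module.finrank_pos_iff_exists_ne_zero.2 ⟨1, fun h ↦ CorrRing.kunnethIdem_ne_zero X.toIsog.Φ f hf f' ⟨0, by omega⟩ ?_⟩
    have h1 : (1 : CorrRing X.toIsog.Φ f hf f') = 0 := congrArg Subtype.val h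
    rw [← mul_one (CorrRing.kunnethIdem X.toIsog.Φ f hf f' _), h1, mul_zero]
  obtain ⟨b, hb⟩ : ∃ b, gX = b + 1 := ⟨gX - 1, by omega⟩
  obtain ⟨hTX, hX0, hgX, hcX, hgXX, hgg₂, hN', hgT, hbc₁, hl₁, hl₁', h7, h7', hmX, hΛL, h9, h9'⟩ := tower_degrees₅₀ hb
  let eX : Fin (2 * gX) ≃ X.toIsog.ι := (finCongr (two_mul gX)).trans f
  let eXX : Fin (2 * (gX + gX)) ≃ (prodObj X X).toIsog.ι := (finCongr hcX.symm).trans (finSumFinEquiv.symm.trans (eX.sumCongr eX))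
  let eT : Fin (2 * (gX + (gX + gX))) ≃ (prodObj X (prodObj X X)).toIsog.ι := (finCongr hN'.symm).trans (finSumFinEquiv.symm.trans (eX.sumCongr eXX))
  exact card_kunnemannIndex_le_finrank_lefschetzCorr_of_nsDivPower_eq X hTX eX eXX eT hX0 hgX hcX hgXX hgg₂ hN' hgT f hf f' θ _ hbc₁ hl₁ hl₁' h7 h7' hmX hΛL h9 h9'
    (IsRiemannForm.exists_apply_ne_zero X.toIsog.Φ hθ) hθ rfl (nsDivPower_top_eq_zsmul_pointIntegralHodgeClass X eX hθ hd)
    (fun s₀ k hk ↦ lefschetzFamilyConstant_ne_zero (neg_one_pow_mul_prod_ne_zero₅₀ X hθ hd) s₀ k hk)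

end Polarized

/-! ## §5 Completeness `Σ_a e_a = 1` and the Euler characteristics of the pieces (appended, g44-#7) -/

section Complete

variable (X : ComplexTorusCat) {gX gXX gT : ℕ} (hTX : gXX + gX = gT) (eX : Fin (2 * gX) ≃ X.toIsog.ι) (eXX : Fin (2 * gXX) ≃ (prodObj X X).toIsog.ι)
  (eT : Fin (2 * gT) ≃ (prodObj X (prodObj X X)).toIsog.ι) (hX0 : 2 * gX + 2 * 0 = 2 * gX) (hgX : gX + gX = 2 * gX) (hcX : 2 * gX + 2 * gX = 2 * gXX)
  (hgXX : gXX + gXX = 2 * gXX) (hgg₂ : gX + gX = gXX) (hN' : 2 * gX + 2 * gXX = 2 * gT) (hgT : gT + gT = 2 * gT)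
  (f : Fin (gX + gX) ≃ X.toIsog.ι) (hf : orientationSign X.toIsog.Φ f = 1) (f' : Fin ((gX + gX) + (gX + gX)) ≃ X.toIsog.ι ⊕ X.toIsog.ι)
  (Θ : neronSeveriGroup X.toIsog.Φ) (D : ℤ) {c₁ bc m₂ d₂ l₁ l₇ l₉ : ℕ} (hbc₁ : bc + 1 = gXX)
  (hl₁ : l₁ + 2 * 1 = 2 * gX) (hl₁' : l₁ + 2 * c₁ = 2 * gXX) (h7 : l₇ + 2 * bc = 2 * gT) (h7' : l₇ + 2 * m₂ = 2 * gXX) (hmX : m₂ + gX = bc)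
  (hΛL : m₂ + c₁ = d₂) (h9 : l₉ + 2 * d₂ = 2 * gT) (h9' : l₉ + 2 * gX = 2 * gXX)
  (hnd : ∀ v : X.toIsog.E, v ≠ 0 → ∃ w : X.toIsog.E, (Θ : X.toIsog.E [⋀^Fin 2]→L[ℝ] ℝ) ![v, w] ≠ 0)

/-- **Weight `s ≤ g`: `Σ_{i ≤ s/2} e_{s,i} = π_s`** (✔ g43-#6 `sum_inv_smul_…_lefschetzFamily` on the complete tower `s = (s mod 2) + 2⌊s/2⌋`). [cite: Milne1999LefschetzClasses, §5 p. 664 (p0026 L42–L50)]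
[cite: Lange2023AbelianVarietiesComplex, §6.3.4 Prop. 6.3.9 (p0317–p0318)] [cite: Kunnemann1993] -/
theorem sum_kunnemannFamily_inl (hΘ : nsDivPower X Θ gX = D • pointIntegralHodgeClass X eX) (hN : ∀ s₀ k, s₀ + 2 * k ≤ gX + 1 → lefschetzFamilyConstant gX D s₀ k ≠ 0)
    (s : Fin (gX + 1)) :
    ∑ i : Fin ((s : ℕ) / 2 + 1), kunnemannFamily X hTX eX eXX eT hX0 hgX hcX hgXX hgg₂ hN' hgT f hf f' Θ D hbc₁ hl₁ hl₁' h7 h7' hmX hΛL h9 h9' (Sum.inl ⟨s, i⟩) =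
      CorrRing.kunnethIdem X.toIsog.Φ f hf f' s := by
  have hks : (s : ℕ) % 2 + 2 * ((s : ℕ) / 2) ≤ gX + 1 := by have := Nat.mod_add_div (s : ℕ) 2; have := s.2; omega
  have h := sum_inv_smul_integralHodgeClassesCorrRingHom_lefschetzFamily X hTX eX eXX eT hX0 hgX hcX hgXX hgg₂ hN' hgT f hf f' Θ D hbc₁ hl₁ hl₁' h7 h7' hmX hΛL h9 h9' hΘ _ _ hks (hN _ _ hks)
  rw [Nat.mod_add_div] at h
  exact h

/-- **Co-weight `t < g`: `Σ_{i ≤ t/2} e′_{t,i} = π_{2g−t}`** (✔ g44-#2 `sum_inv_smul_…_pushforward_swapHom_lefschetzFamily`). [cite: Milne1999LefschetzClasses, §5 p. 664 (p0026 L42–L50) and Thm. 5.9]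
[cite: Lange2023AbelianVarietiesComplex, §6.3.4 Prop. 6.3.10 (p0318)] [cite: Kunnemann1993] -/
theorem sum_kunnemannFamily_inr (hΘ : nsDivPower X Θ gX = D • pointIntegralHodgeClass X eX) (hN : ∀ s₀ k, s₀ + 2 * k ≤ gX + 1 → lefschetzFamilyConstant gX D s₀ k ≠ 0)
    (t : Fin gX) :
    ∑ i : Fin ((t : ℕ) / 2 + 1), kunnemannFamily X hTX eX eXX eT hX0 hgX hcX hgXX hgg₂ hN' hgT f hf f' Θ D hbc₁ hl₁ hl₁' h7 h7' hmX hΛL h9 h9' (Sum.inr ⟨t, i⟩) =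
      CorrRing.kunnethIdem X.toIsog.Φ f hf f' (gX + gX - t) := by
  have hkt : (t : ℕ) % 2 + 2 * ((t : ℕ) / 2) ≤ gX + 1 := by have := Nat.mod_add_div (t : ℕ) 2; have := t.2; omega
  exact sum_inv_smul_integralHodgeClassesCorrRingHom_pushforward_swapHom_lefschetzFamily X hTX eX eXX eT hX0 hgX hcX hgXX hgg₂ hN' hgT f hf f' Θ D hbc₁ hl₁ hl₁' h7 h7' hmX hΛL h9 h9' hΘ _ _ hkt
    (hN _ _ hkt) (by have := Nat.mod_add_div (t : ℕ) 2; have := t.2; omega)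

/-- **KÜNNEMANN's REFINED LEFSCHETZ DECOMPOSITION OF `h(X)` IS COMPLETE: `Σ_{a ∈ KunnemannIndex g} e_a = 1 = [Δ_X]`** — the `#KunnemannIndex g = Σ_{s=0}^{2g}(⌊min(s,2g−s)/2⌋+1)` pairwise orthogonal
non-zero idempotents `e_{s,i}` (`s ≤ g`) and `e′_{t,i} = ᵗe_{t,i}` (`t < g`, weight `2g − t`) of §3 sum to the identity: weight by weight they give the Künneth projectors `π_s`, and `Σ_{s=0}^{2g} π_s = [Δ]`
(p08 `sum_kunnethIdem`). Hence `h(X) = ⊕_a (X, e_a)` in Kahn's pseudo-abelian envelope, refining `h(X) = ⊕_s hˢ(X)`. [cite: Kunnemann1993] [cite: GreenMurreVoisin1994, Murre §7.18 (3) (p0128 L9)]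
[cite: Milne1999LefschetzClasses, §5 p. 664 (p0026 L42–L50) and Thm. 5.9] [cite: Lange2023AbelianVarietiesComplex, §6.3.4 p. 317 (`Δ = Σ_{i=0}^{2g} π_i`)] [cite: Kahn2020, App. A Thm. A.6 (p0135)] -/
theorem sum_kunnemannFamily (hΘ : nsDivPower X Θ gX = D • pointIntegralHodgeClass X eX) (hN : ∀ s₀ k, s₀ + 2 * k ≤ gX + 1 → lefschetzFamilyConstant gX D s₀ k ≠ 0) :
    ∑ a, kunnemannFamily X hTX eX eXX eT hX0 hgX hcX hgXX hgg₂ hN' hgT f hf f' Θ D hbc₁ hl₁ hl₁' h7 h7' hmX hΛL h9 h9' a = 1 := by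
  rw [Fintype.sum_sum_type, Fintype.sum_sigma, Fintype.sum_sigma]
  simp only [sum_kunnemannFamily_inl X hTX eX eXX eT hX0 hgX hcX hgXX hgg₂ hN' hgT f hf f' Θ D hbc₁ hl₁ hl₁' h7 h7' hmX hΛL h9 h9' hΘ hN,
    sum_kunnemannFamily_inr X hTX eX eXX eT hX0 hgX hcX hgXX hgg₂ hN' hgT f hf f' Θ D hbc₁ hl₁ hl₁' h7 h7' hmX hΛL h9 h9' hΘ hN]
  rw [Fin.sum_univ_eq_sum_range (fun s : ℕ ↦ CorrRing.kunnethIdem X.toIsog.Φ f hf f' s), Fin.sum_univ_eq_sum_range (fun t : ℕ ↦ CorrRing.kunnethIdem X.toIsog.Φ f hf f' (gX + gX - t)),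
    ← CorrRing.sum_kunnethIdem X.toIsog.Φ f hf f']
  -- `range (2g + 1) = range (g + 1) ∪ ((g + 1) + range g)`, and reflect `range g`
  have hsplit := Finset.sum_range_add (fun s ↦ CorrRing.kunnethIdem X.toIsog.Φ f hf f' s) (gX + 1) gX
  have hrefl := Finset.sum_range_reflect (fun t ↦ CorrRing.kunnethIdem X.toIsog.Φ f hf f' (gX + 1 + t)) gX
  rw [show gX + 1 + gX = gX + gX + 1 by omega] at hsplit
  rw [hsplit, ← hrefl]
  congr 1
  exact Finset.sum_congr rfl fun t ht ↦ by
    have := Finset.mem_range.1 ht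
    rw [show gX + 1 + (gX - 1 - t) = gX + gX - t by omega]

include hnd in
/-- **`χ((X, e_{s,i})) = τ(e_{s,i}) = (−1)ˢ b^pr_{s−2i}`** for the members of weight `s ≤ g` of the full family (✔ g43-#6 `traceForm_inv_smul_…_eq_primitiveBettiNumber` on the complete tower).
[cite: Kahn2020, App. A Def. A.35 and Examples A.39 (2) (p0141–p0142)] [cite: Fulton1998, §16.1 Example 16.1.15 (p0302 L27–L40)] [cite: Kunnemann1993] -/
theorem traceForm_kunnemannFamily_inl (hΘ : nsDivPower X Θ gX = D • pointIntegralHodgeClass X eX) (hN : ∀ s₀ k, s₀ + 2 * k ≤ gX + 1 → lefschetzFamilyConstant gX D s₀ k ≠ 0)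
    (s : Fin (gX + 1)) (i : Fin ((s : ℕ) / 2 + 1)) :
    CorrRing.traceForm X.toIsog.Φ f hf f' (kunnemannFamily X hTX eX eXX eT hX0 hgX hcX hgXX hgg₂ hN' hgT f hf f' Θ D hbc₁ hl₁ hl₁' h7 h7' hmX hΛL h9 h9' (Sum.inl ⟨s, i⟩)) =
      (-1 : ℂ) ^ (s : ℕ) * (primitiveBettiNumber gX ((s : ℕ) - 2 * (i : ℕ)) : ℂ) := by
  have hks : (s : ℕ) % 2 + 2 * ((s : ℕ) / 2) ≤ gX + 1 := by have := Nat.mod_add_div (s : ℕ) 2; have := s.2; omega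
  have h := traceForm_inv_smul_integralHodgeClassesCorrRingHom_lefschetzFamily_eq_primitiveBettiNumber X hTX eX eXX eT hX0 hgX hcX hgXX hgg₂ hN' hgT f hf f' Θ D hbc₁ hl₁ hl₁' h7 h7' hmX hΛL h9 h9' hnd hΘ
    _ _ hks (by have := Nat.mod_add_div (s : ℕ) 2; have := s.2; omega) (hN _ _ hks) i (Or.inr (by omega))
    (m := (s : ℕ) - 2 * (i : ℕ)) (by have := Nat.mod_add_div (s : ℕ) 2; have := i.2; omega)
  rw [Nat.mod_add_div] at h
  exact h

include hnd in
/-- **`χ((X, e′_{t,i})) = τ(e′_{t,i}) = (−1)ᵗ b^pr_{t−2i}`** for the transposed members (co-weight `t < g`, weight `2g − t`; `τ(ᵗa) = τ(a)`, ✔ g44-#2). [cite: Kahn2020, App. A Def. A.35 and Examples A.39 (2) (p0141–p0142)]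
[cite: Fulton1998, §16.1 Example 16.1.15 (p0302 L27–L40)] [cite: Kunnemann1993] -/
theorem traceForm_kunnemannFamily_inr (hΘ : nsDivPower X Θ gX = D • pointIntegralHodgeClass X eX) (hN : ∀ s₀ k, s₀ + 2 * k ≤ gX + 1 → lefschetzFamilyConstant gX D s₀ k ≠ 0)
    (t : Fin gX) (i : Fin ((t : ℕ) / 2 + 1)) :
    CorrRing.traceForm X.toIsog.Φ f hf f' (kunnemannFamily X hTX eX eXX eT hX0 hgX hcX hgXX hgg₂ hN' hgT f hf f' Θ D hbc₁ hl₁ hl₁' h7 h7' hmX hΛL h9 h9' (Sum.inr ⟨t, i⟩)) =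
      (-1 : ℂ) ^ (t : ℕ) * (primitiveBettiNumber gX ((t : ℕ) - 2 * (i : ℕ)) : ℂ) := by
  have hkt : (t : ℕ) % 2 + 2 * ((t : ℕ) / 2) ≤ gX + 1 := by have := Nat.mod_add_div (t : ℕ) 2; have := t.2; omega
  have h := traceForm_inv_smul_integralHodgeClassesCorrRingHom_pushforward_swapHom_lefschetzFamily_eq_primitiveBettiNumber X hTX eX eXX eT hX0 hgX hcX hgXX hgg₂ hN' hgT f hf f' Θ D hbc₁ hl₁ hl₁' h7 h7' hmX
    hΛL h9 h9' hnd hΘ _ _ hkt (by have := Nat.mod_add_div (t : ℕ) 2; have := t.2; omega) (hN _ _ hkt) i (Or.inr (by omega))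
    (m := (t : ℕ) - 2 * (i : ℕ)) (by have := Nat.mod_add_div (t : ℕ) 2; have := i.2; omega)
  rw [Nat.mod_add_div] at h
  exact h

/-- **`Σ_a χ((X, e_a)) = τ(Σ_a e_a) = τ(1) = χ(X) = 0`** (`g ≥ 1`): Kahn's additivity of the Euler characteristic over the complete decomposition `1 = Σ_a e_a` (p08 `traceForm_sum`, `traceForm_one`).
[cite: Kahn2020, App. A Def. A.38 and Examples A.39 (2)] [cite: Fulton1998, §16.1 Example 16.1.15 (p0302 L27–L40)] [cite: Kunnemann1993] -/
theorem sum_traceForm_kunnemannFamily (hΘ : nsDivPower X Θ gX = D • pointIntegralHodgeClass X eX) (hN : ∀ s₀ k, s₀ + 2 * k ≤ gX + 1 → lefschetzFamilyConstant gX D s₀ k ≠ 0) (h1 : 1 ≤ gX) :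
    ∑ a, CorrRing.traceForm X.toIsog.Φ f hf f' (kunnemannFamily X hTX eX eXX eT hX0 hgX hcX hgXX hgg₂ hN' hgT f hf f' Θ D hbc₁ hl₁ hl₁' h7 h7' hmX hΛL h9 h9' a) = 0 := by
  rw [← CorrRing.traceForm_sum, sum_kunnemannFamily X hTX eX eXX eT hX0 hgX hcX hgXX hgg₂ hN' hgT f hf f' Θ D hbc₁ hl₁ hl₁' h7 h7' hmX hΛL h9 h9' hΘ hN,
    CorrRing.traceForm_one X.toIsog.Φ f hf f' (h1.trans (Nat.le_add_right _ _))]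

include hTX eX eXX eT hX0 hgX hcX hgXX hgg₂ hN' hgT f hf f' Θ D hbc₁ hl₁ hl₁' h7 h7' hmX hΛL h9 h9' hnd in
/-- **THE EULER CHARACTERISTICS OF KÜNNEMANN's PIECES ADD UP TO `χ(X) = 0`: `Σ_{s ≤ g} Σ_{i ≤ s/2} (−1)ˢ b^pr_{s−2i} + Σ_{t < g} Σ_{i ≤ t/2} (−1)ᵗ b^pr_{t−2i} = 0`** (`g ≥ 1`; `b^pr_m = C(2g,m) − C(2g,m−2)`), read off a
complex torus `X` of dimension `g` with `Θ^{[g]} = D·[pt]` and all `N_s ≠ 0`. [cite: Kahn2020, App. A Def. A.35, A.38 and Examples A.39 (2)] [cite: Lange2023AbelianVarietiesComplex, §1.1.3 Cor. 1.1.19; §7.3.2 (3) (p0338 L12–L16)]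
[cite: Kunnemann1993] -/
theorem sum_neg_one_pow_mul_primitiveBettiNumber_kunnemannIndex_eq_zero (hΘ : nsDivPower X Θ gX = D • pointIntegralHodgeClass X eX)
    (hN : ∀ s₀ k, s₀ + 2 * k ≤ gX + 1 → lefschetzFamilyConstant gX D s₀ k ≠ 0) (h1 : 1 ≤ gX) :
    (∑ s : Fin (gX + 1), ∑ i : Fin ((s : ℕ) / 2 + 1), (-1 : ℤ) ^ (s : ℕ) * (primitiveBettiNumber gX ((s : ℕ) - 2 * (i : ℕ)) : ℤ)) +
        ∑ t : Fin gX, ∑ i : Fin ((t : ℕ) / 2 + 1), (-1 : ℤ) ^ (t : ℕ) * (primitiveBettiNumber gX ((t : ℕ) - 2 * (i : ℕ)) : ℤ) = 0 := by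
  have h := sum_traceForm_kunnemannFamily X hTX eX eXX eT hX0 hgX hcX hgXX hgg₂ hN' hgT f hf f' Θ D hbc₁ hl₁ hl₁' h7 h7' hmX hΛL h9 h9' hΘ hN h1
  rw [Fintype.sum_sum_type, Fintype.sum_sigma, Fintype.sum_sigma] at h
  simp only [traceForm_kunnemannFamily_inl X hTX eX eXX eT hX0 hgX hcX hgXX hgg₂ hN' hgT f hf f' Θ D hbc₁ hl₁ hl₁' h7 h7' hmX hΛL h9 h9' hnd hΘ hN,
    traceForm_kunnemannFamily_inr X hTX eX eXX eT hX0 hgX hcX hgXX hgg₂ hN' hgT f hf f' Θ D hbc₁ hl₁ hl₁' h7 h7' hmX hΛL h9 h9' hnd hΘ hN] at h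
  exact_mod_cast h

end Complete

end ComplexTorusCat

end Literature.AlgebraicGeometry.HodgeTheory

end
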